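import Summits.HodgeConjecture.HodgeConjecture.Theorems.CYFormCasimirCYFormCarrierEightEquivSU
import Summits.HodgeConjecture.HodgeConjecture.Theorems.CYFormCasimirCYFormCarrierEightCoeffTwist
import Summits.HodgeConjecture.HodgeConjecture.Theorems.CYFormCasimirCYFormCarrierEightAntiInvolution
import Literature.AlgebraicGeometry.HodgeTheory.ChernCharacterBetti
import HarnessLib

/-!
# Crux X1 `CYFormCarrierEight` (route `CYFormCasimir`, stmt-HodgeConjecture-23493), helper file 18:
# Galois behaviour of the duality operators: `σ_* s₊ = s₊ σ_*` (`σ(i√d) = i√d`), `σ_* s₊ = s₋ σ_*` (`σ(i√d) = -i√d`)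

research route conditional on HC_CM; not a corollary. Nothing here proves HC, HC_CM, the rung H2, X1 or
`stub_cyform_exists`; step S4 of `Cruxes/CYFormCarrierEight/STUB-PLAN-stub_cyform_exists.md`.

For a coefficient automorphism `σ ∈ Aut(ℂ)` with twist `σ_* = coeffClass σ` (semilinear, multiplicative, fixing rational classes)
and the duality operators `s₊` (datum `v`), `s₋` (datum `v'`) of helper files 14–17 on a Hodge-general Weil eightfold:
* `topCoord_coeffClass`, `tri_coeffClass` — `tr(σ_* t) = σ(tr t) · tr(σ_* ω_A)`, so the triple products transform by `σ`
  up to the common non-zero factor `tr(σ_* ω_A)`;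
* `coeffClass_weilComponents_of_fix/of_swap` — the two components `v ∈ ⋀⁸W^*`, `v' ∈ ⋀⁸W` of a RATIONAL Weil class are fixed
  by `σ_*` when `σ(i√d) = i√d` and exchanged when `σ(i√d) = -i√d`;
* `starPlus_coeffClass_of_fix`, `starMinus_coeffClass_of_fix` — then `σ_*(s₊ x) = s₊(σ_* x)`, `σ_*(s₋ y) = s₋(σ_* y)`;
  `starPlus_coeffClass_of_swap`, `starMinus_coeffClass_of_swap` — resp. `σ_*(s₊ x) = s₋(σ_* x)`, `σ_*(s₋ y) = s₊(σ_* y)`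
  (both sides satisfy the same defining identity: uniqueness, helper file 16);
* `starSum_coeffClass_comm` — hence **`s₊ + s₋` commutes with every `σ_*` on the Weil space `⋀⁴W ⊕ ⋀⁴W^*`** (the pair
  `(s₊, s₋)` is Galois-equivariant BY CONSTRUCTION; with helper file 6 this is the rationality clause of the CY form).

References: Deligne1982HodgeCycles (I §3), FriedmanLaza2013 (§3.5 Lemma 36, Prop. 37), vanGeemen1994HodgeAV (4.9, Lemma 5.2 (6)).
-/

-- `Summit.HodgeConjecture.HodgeConjecture.…` is the tree's mandated summit/problem namespace (single-problem summit).
set_option linter.dupNamespace false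
noncomputable section

open CategoryTheory
open Literature.AlgebraicTopology.SingularHomology
open Literature.AlgebraicGeometry.Motives
open Literature.AlgebraicGeometry.HodgeTheory
open Literature.AlgebraicGeometry.VanGeemen1994

namespace Summit.HodgeConjecture.HodgeConjecture.Theorems.CYFormCarrier

section Galois

variable {A : AbelianVariety ℂ} {d : ℕ} {φ : A ⟶ A}
variable (hd : 0 < d) (hA : A.dim = 2 * 4) (hφ : φ ≫ φ = -(d • 𝟙 A))
  (e : ProjectiveEmbedding A.X) {a : complexBetti (projectiveSpace e.n ℂ) 2} (ha : IsRationalClass a)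
  (ha0 : a ≠ 0) (σ : ℂ ≃+* ℂ)

/-! ## §1 The twist on the top line and on triple products -/

/-- `tr(σ_* t) = σ(tr t) · tr(σ_* ω_A)` on the top line `H¹⁶ = ℂ · ω_A`. [cite: Deligne1982HodgeCycles, I §3] -/
theorem topCoord_coeffClass (t : complexBetti A.X (2 + 2 * 7)) :
    topCoord (dim_eq_seven_add_one hA) (coeffClass (R := ℂ) (S := ℂ) σ.toRingHom.toAddMonoidHom (2 + 2 * 7) t) =
      σ (topCoord (dim_eq_seven_add_one hA) t) *
        topCoord (dim_eq_seven_add_one hA)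
          (coeffClass (R := ℂ) (S := ℂ) σ.toRingHom.toAddMonoidHom (2 + 2 * 7) (topGen (dim_eq_seven_add_one hA))) := by
  conv_lhs => rw [← topCoord_smul_topGen (dim_eq_seven_add_one hA) t, coeffClass_ringHom_smul, map_smul, smul_eq_mul]
  rfl

/-- `tr(σ_* ω_A) ≠ 0` (`σ_*` is injective and `ω_A ≠ 0`). [cite: Deligne1982HodgeCycles, I §3] -/
theorem topCoord_coeffClass_topGen_ne_zero :
    topCoord (dim_eq_seven_add_one hA)
      (coeffClass (R := ℂ) (S := ℂ) σ.toRingHom.toAddMonoidHom (2 + 2 * 7) (topGen (dim_eq_seven_add_one hA))) ≠ 0 := by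
  intro h0
  have h := topCoord_smul_topGen (dim_eq_seven_add_one hA)
    (coeffClass (R := ℂ) (S := ℂ) σ.toRingHom.toAddMonoidHom (2 + 2 * 7) (topGen (dim_eq_seven_add_one hA)))
  rw [h0, zero_smul] at h
  have hinj := coeffClass_ringEquiv_injective (Y := ComplexPoints A.X) σ (2 + 2 * 7)
  have h1 : topGen (dim_eq_seven_add_one hA) = 0 := hinj (by rw [← h, map_zero])
  have hne : topGen (dim_eq_seven_add_one hA) ≠ 0 := by
    rw [topGen]; exact Module.Basis.ne_zero _ _
  exact hne h1

/-- **Triple products transform by `σ`**: `tr((σ_* z ∪ σ_* y) ∪ σ_* p) = σ(tr((z ∪ y) ∪ p)) · tr(σ_* ω_A)`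
(`σ_*` is multiplicative). [cite: HatcherAT2002, §3.2 Prop. 3.10] [cite: Deligne1982HodgeCycles, I §3] -/
theorem tri_coeffClass (z y : complexBetti A.X (2 * 2)) (p : complexBetti A.X (2 * 4)) :
    topCoord (dim_eq_seven_add_one hA)
        (cupProduct (show 2 * 4 + 2 * 4 = 2 + 2 * 7 from rfl)
          (cupProduct (show 2 * 2 + 2 * 2 = 2 * 4 from rfl)
            (coeffClass (R := ℂ) (S := ℂ) σ.toRingHom.toAddMonoidHom (2 * 2) z)
            (coeffClass (R := ℂ) (S := ℂ) σ.toRingHom.toAddMonoidHom (2 * 2) y))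
          (coeffClass (R := ℂ) (S := ℂ) σ.toRingHom.toAddMonoidHom (2 * 4) p)) =
      σ (topCoord (dim_eq_seven_add_one hA)
        (cupProduct (show 2 * 4 + 2 * 4 = 2 + 2 * 7 from rfl)
          (cupProduct (show 2 * 2 + 2 * 2 = 2 * 4 from rfl) z y) p)) *
        topCoord (dim_eq_seven_add_one hA)
          (coeffClass (R := ℂ) (S := ℂ) σ.toRingHom.toAddMonoidHom (2 + 2 * 7) (topGen (dim_eq_seven_add_one hA))) := by
  rw [← coeffClass_ringHom_cupProduct, ← coeffClass_ringHom_cupProduct, topCoord_coeffClass hA σ]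

include ha in
/-- `σ_* h_K⁴ = h_K⁴` (`h_K` is rational). [cite: Deligne1982HodgeCycles, I §3] -/
theorem coeffClass_cupPowTwo_hK_four :
    coeffClass (R := ℂ) (S := ℂ) σ.toRingHom.toAddMonoidHom (2 * 4) (cupPowTwo (hK d φ e a) 4) = cupPowTwo (hK d φ e a) 4 :=
  ((isRationalClass_ksymm d φ e ha).cupPowTwo 4).coeffClass_ringHom_eq σ.toRingHom

/-! ## §2 The components of a rational Weil class under `σ_*` -/

include hd in
/-- If `σ(i√d) = i√d`, `σ_*` FIXES both components `v' ∈ ⋀⁸W`, `v ∈ ⋀⁸W^*` of a rational class `w₀ = v' + v` of the Weil plane.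
[cite: vanGeemen1994HodgeAV, Lemma 5.2 (6)] [cite: Deligne1982HodgeCycles, I §3] -/
theorem coeffClass_weilComponents_of_fix (hσ : σ (Complex.I * (Real.sqrt d : ℂ)) = Complex.I * (Real.sqrt d : ℂ))
    {v' v : complexBetti A.X (2 * 4)} (hv' : v' ∈ weilClassesPlus A φ 4 d) (hv : v ∈ weilClassesMinus A φ 4 d)
    (hw : IsRationalClass (v' + v)) :
    coeffClass (R := ℂ) (S := ℂ) σ.toRingHom.toAddMonoidHom (2 * 4) v' = v' ∧
      coeffClass (R := ℂ) (S := ℂ) σ.toRingHom.toAddMonoidHom (2 * 4) v = v := by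
  have h0 : weilClassesPlus A φ 4 d ⊓ weilClassesMinus A φ 4 d = ⊥ := weilClassesPlus_inf_weilClassesMinus (by norm_num) hd
  have hsum : coeffClass (R := ℂ) (S := ℂ) σ.toRingHom.toAddMonoidHom (2 * 4) v' +
      coeffClass (R := ℂ) (S := ℂ) σ.toRingHom.toAddMonoidHom (2 * 4) v = v' + v := by
    rw [← map_add]; exact hw.coeffClass_ringHom_eq σ.toRingHom
  have h1 : coeffClass (R := ℂ) (S := ℂ) σ.toRingHom.toAddMonoidHom (2 * 4) v' ∈ weilClassesPlus A φ 4 d :=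
    coeffClass_mem_weilClassesPlus_of_fix σ.toRingHom hσ hv'
  have h2 : coeffClass (R := ℂ) (S := ℂ) σ.toRingHom.toAddMonoidHom (2 * 4) v ∈ weilClassesMinus A φ 4 d :=
    coeffClass_mem_weilClassesMinus_of_fix σ.toRingHom hσ hv
  -- the difference lies in `⋀⁸W ∩ ⋀⁸W^* = 0`
  have hdiff : coeffClass (R := ℂ) (S := ℂ) σ.toRingHom.toAddMonoidHom (2 * 4) v' - v' =
      v - coeffClass (R := ℂ) (S := ℂ) σ.toRingHom.toAddMonoidHom (2 * 4) v := by
    rw [sub_eq_sub_iff_add_eq_add, hsum, add_comm]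
  have hmem : coeffClass (R := ℂ) (S := ℂ) σ.toRingHom.toAddMonoidHom (2 * 4) v' - v' ∈
      weilClassesPlus A φ 4 d ⊓ weilClassesMinus A φ 4 d :=
    ⟨Submodule.sub_mem _ h1 hv', by rw [hdiff]; exact Submodule.sub_mem _ hv h2⟩
  rw [h0, Submodule.mem_bot] at hmem
  have e1 := sub_eq_zero.1 hmem
  refine ⟨e1, ?_⟩
  have e2 : v - coeffClass (R := ℂ) (S := ℂ) σ.toRingHom.toAddMonoidHom (2 * 4) v = 0 := by rw [← hdiff, hmem]
  exact (sub_eq_zero.1 e2).symm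

include hd in
/-- If `σ(i√d) = -i√d`, `σ_*` EXCHANGES the components of a rational class of the Weil plane: `σ_* v' = v`, `σ_* v = v'`.
[cite: vanGeemen1994HodgeAV, Lemma 5.2 (6)] [cite: Deligne1982HodgeCycles, I §3] -/
theorem coeffClass_weilComponents_of_swap (hσ : σ (Complex.I * (Real.sqrt d : ℂ)) = -(Complex.I * (Real.sqrt d : ℂ)))
    {v' v : complexBetti A.X (2 * 4)} (hv' : v' ∈ weilClassesPlus A φ 4 d) (hv : v ∈ weilClassesMinus A φ 4 d)
    (hw : IsRationalClass (v' + v)) :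
    coeffClass (R := ℂ) (S := ℂ) σ.toRingHom.toAddMonoidHom (2 * 4) v' = v ∧
      coeffClass (R := ℂ) (S := ℂ) σ.toRingHom.toAddMonoidHom (2 * 4) v = v' := by
  have h0 : weilClassesPlus A φ 4 d ⊓ weilClassesMinus A φ 4 d = ⊥ := weilClassesPlus_inf_weilClassesMinus (by norm_num) hd
  have hsum : coeffClass (R := ℂ) (S := ℂ) σ.toRingHom.toAddMonoidHom (2 * 4) v' +
      coeffClass (R := ℂ) (S := ℂ) σ.toRingHom.toAddMonoidHom (2 * 4) v = v' + v := by
    rw [← map_add]; exact hw.coeffClass_ringHom_eq σ.toRingHom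
  have h1 : coeffClass (R := ℂ) (S := ℂ) σ.toRingHom.toAddMonoidHom (2 * 4) v' ∈ weilClassesMinus A φ 4 d :=
    coeffClass_mem_weilClassesMinus_of_swap σ.toRingHom hσ hv'
  have h2 : coeffClass (R := ℂ) (S := ℂ) σ.toRingHom.toAddMonoidHom (2 * 4) v ∈ weilClassesPlus A φ 4 d :=
    coeffClass_mem_weilClassesPlus_of_swap σ.toRingHom hσ hv
  have hdiff : coeffClass (R := ℂ) (S := ℂ) σ.toRingHom.toAddMonoidHom (2 * 4) v - v' =
      v - coeffClass (R := ℂ) (S := ℂ) σ.toRingHom.toAddMonoidHom (2 * 4) v' := by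
    rw [sub_eq_sub_iff_add_eq_add, add_comm, hsum, add_comm]
  have hmem : coeffClass (R := ℂ) (S := ℂ) σ.toRingHom.toAddMonoidHom (2 * 4) v - v' ∈
      weilClassesPlus A φ 4 d ⊓ weilClassesMinus A φ 4 d :=
    ⟨Submodule.sub_mem _ h2 hv', by rw [hdiff]; exact Submodule.sub_mem _ hv h1⟩
  rw [h0, Submodule.mem_bot] at hmem
  have e1 := sub_eq_zero.1 hmem
  refine ⟨?_, e1⟩
  have e2 : v - coeffClass (R := ℂ) (S := ℂ) σ.toRingHom.toAddMonoidHom (2 * 4) v' = 0 := by rw [← hdiff, hmem]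
  exact (sub_eq_zero.1 e2).symm

/-! ## §3 The duality operators under `σ_*` -/

variable (S S' : complexBetti A.X (2 * 2) →ₗ[ℂ] complexBetti A.X (2 * 2)) (v v' : complexBetti A.X (2 * 4))
  (hS1 : ∀ x ∈ weilClassesPlus A φ 2 d, S x ∈ weilClassesMinus A φ 2 d)
  (hS2 : ∀ x ∈ weilClassesPlus A φ 2 d, ∀ z ∈ weilClassesPlus A φ 2 d,
    topCoord (dim_eq_seven_add_one hA)
        (cupProduct (show 2 * 4 + 2 * 4 = 2 + 2 * 7 from rfl)
          (cupProduct (show 2 * 2 + 2 * 2 = 2 * 4 from rfl) z (S x)) (cupPowTwo (hK d φ e a) 4)) =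
      topCoord (dim_eq_seven_add_one hA)
        (cupProduct (show 2 * 4 + 2 * 4 = 2 + 2 * 7 from rfl)
          (cupProduct (show 2 * 2 + 2 * 2 = 2 * 4 from rfl) z x) v))
  (hS'1 : ∀ y ∈ weilClassesMinus A φ 2 d, S' y ∈ weilClassesPlus A φ 2 d)
  (hS'2 : ∀ y ∈ weilClassesMinus A φ 2 d, ∀ z' ∈ weilClassesMinus A φ 2 d,
    topCoord (dim_eq_seven_add_one hA)
        (cupProduct (show 2 * 4 + 2 * 4 = 2 + 2 * 7 from rfl)
          (cupProduct (show 2 * 2 + 2 * 2 = 2 * 4 from rfl) z' (S' y)) (cupPowTwo (hK d φ e a) 4)) =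
      topCoord (dim_eq_seven_add_one hA)
        (cupProduct (show 2 * 4 + 2 * 4 = 2 + 2 * 7 from rfl)
          (cupProduct (show 2 * 2 + 2 * 2 = 2 * 4 from rfl) z' y) v'))

include hd hA hφ e ha ha0 hS1 hS2 in
/-- **`σ_*(s₊ x) = s₊(σ_* x)` for `x ∈ ⋀⁴W` when `σ(i√d) = i√d` and `σ_* v = v`.** [cite: FriedmanLaza2013, §3.5 Lemma 36]
[cite: Deligne1982HodgeCycles, I §3] -/
theorem starPlus_coeffClass_of_fix (hSU : HasHodgeGroupSU A φ 4 d (hK d φ e a))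
    (hσ : σ (Complex.I * (Real.sqrt d : ℂ)) = Complex.I * (Real.sqrt d : ℂ))
    (hτv : coeffClass (R := ℂ) (S := ℂ) σ.toRingHom.toAddMonoidHom (2 * 4) v = v)
    {x : complexBetti A.X (2 * 2)} (hx : x ∈ weilClassesPlus A φ 2 d) :
    coeffClass (R := ℂ) (S := ℂ) σ.toRingHom.toAddMonoidHom (2 * 2) (S x) =
      S (coeffClass (R := ℂ) (S := ℂ) σ.toRingHom.toAddMonoidHom (2 * 2) x) := by
  have hσ' : σ.symm (Complex.I * (Real.sqrt d : ℂ)) = Complex.I * (Real.sqrt d : ℂ) := by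
    rw [RingEquiv.symm_apply_eq, hσ]
  have hτx : coeffClass (R := ℂ) (S := ℂ) σ.toRingHom.toAddMonoidHom (2 * 2) x ∈ weilClassesPlus A φ 2 d :=
    coeffClass_mem_weilClassesPlus_of_fix σ.toRingHom hσ hx
  refine eq_of_beta_eq_right hd hA hφ e ha ha0 hSU (coeffClass_mem_weilClassesMinus_of_fix σ.toRingHom hσ (hS1 x hx))
    (hS1 _ hτx) fun z hz ↦ ?_
  -- `z = σ_* z₀` with `z₀ = σ⁻¹_* z ∈ ⋀⁴W`
  set z₀ := coeffClass (R := ℂ) (S := ℂ) σ.symm.toRingHom.toAddMonoidHom (2 * 2) z with hz₀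
  have hz₀P : z₀ ∈ weilClassesPlus A φ 2 d := coeffClass_mem_weilClassesPlus_of_fix σ.symm.toRingHom hσ' hz
  have hzz : z = coeffClass (R := ℂ) (S := ℂ) σ.toRingHom.toAddMonoidHom (2 * 2) z₀ := (coeffClass_ringEquiv_apply_symm σ z).symm
  rw [hzz, hS2 _ hτx _ (coeffClass_mem_weilClassesPlus_of_fix σ.toRingHom hσ hz₀P)]
  conv_lhs => rw [← coeffClass_cupPowTwo_hK_four (φ := φ) e ha σ, tri_coeffClass hA σ, hS2 x hx z₀ hz₀P]
  conv_rhs => rw [← hτv, tri_coeffClass hA σ]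

include hd hA hφ e ha ha0 hS1 hS2 hS'1 hS'2 in
/-- **`σ_*(s₊ x) = s₋(σ_* x)` for `x ∈ ⋀⁴W` when `σ(i√d) = -i√d` and `σ_* v = v'`.** [cite: FriedmanLaza2013, §3.5 Lemma 36]
[cite: Deligne1982HodgeCycles, I §3] -/
theorem starPlus_coeffClass_of_swap (hSU : HasHodgeGroupSU A φ 4 d (hK d φ e a))
    (hσ : σ (Complex.I * (Real.sqrt d : ℂ)) = -(Complex.I * (Real.sqrt d : ℂ)))
    (hτv : coeffClass (R := ℂ) (S := ℂ) σ.toRingHom.toAddMonoidHom (2 * 4) v = v')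
    {x : complexBetti A.X (2 * 2)} (hx : x ∈ weilClassesPlus A φ 2 d) :
    coeffClass (R := ℂ) (S := ℂ) σ.toRingHom.toAddMonoidHom (2 * 2) (S x) =
      S' (coeffClass (R := ℂ) (S := ℂ) σ.toRingHom.toAddMonoidHom (2 * 2) x) := by
  have hσ' : σ.symm (Complex.I * (Real.sqrt d : ℂ)) = -(Complex.I * (Real.sqrt d : ℂ)) := by
    rw [RingEquiv.symm_apply_eq, map_neg, hσ, neg_neg]
  have hτx : coeffClass (R := ℂ) (S := ℂ) σ.toRingHom.toAddMonoidHom (2 * 2) x ∈ weilClassesMinus A φ 2 d :=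
    coeffClass_mem_weilClassesMinus_of_swap σ.toRingHom hσ hx
  refine eq_of_beta'_eq_left hd hA hφ e ha ha0 hSU (coeffClass_mem_weilClassesPlus_of_swap σ.toRingHom hσ (hS1 x hx))
    (hS'1 _ hτx) fun z' hz' ↦ ?_
  set z₀ := coeffClass (R := ℂ) (S := ℂ) σ.symm.toRingHom.toAddMonoidHom (2 * 2) z' with hz₀
  have hz₀P : z₀ ∈ weilClassesPlus A φ 2 d := coeffClass_mem_weilClassesPlus_of_swap σ.symm.toRingHom hσ' hz'
  have hzz : z' = coeffClass (R := ℂ) (S := ℂ) σ.toRingHom.toAddMonoidHom (2 * 2) z₀ :=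
    (coeffClass_ringEquiv_apply_symm σ z').symm
  rw [hzz, hS'2 _ hτx _ (coeffClass_mem_weilClassesMinus_of_swap σ.toRingHom hσ hz₀P)]
  conv_lhs => rw [← coeffClass_cupPowTwo_hK_four (φ := φ) e ha σ, tri_coeffClass hA σ, hS2 x hx z₀ hz₀P]
  conv_rhs => rw [← hτv, tri_coeffClass hA σ]

include hd hA hφ e ha ha0 hS'1 hS'2 in
/-- **`σ_*(s₋ y) = s₋(σ_* y)` for `y ∈ ⋀⁴W^*` when `σ(i√d) = i√d` and `σ_* v' = v'`.** [cite: FriedmanLaza2013, §3.5 Lemma 36]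
[cite: Deligne1982HodgeCycles, I §3] -/
theorem starMinus_coeffClass_of_fix (hSU : HasHodgeGroupSU A φ 4 d (hK d φ e a))
    (hσ : σ (Complex.I * (Real.sqrt d : ℂ)) = Complex.I * (Real.sqrt d : ℂ))
    (hτv' : coeffClass (R := ℂ) (S := ℂ) σ.toRingHom.toAddMonoidHom (2 * 4) v' = v')
    {y : complexBetti A.X (2 * 2)} (hy : y ∈ weilClassesMinus A φ 2 d) :
    coeffClass (R := ℂ) (S := ℂ) σ.toRingHom.toAddMonoidHom (2 * 2) (S' y) =
      S' (coeffClass (R := ℂ) (S := ℂ) σ.toRingHom.toAddMonoidHom (2 * 2) y) := by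
  have hσ' : σ.symm (Complex.I * (Real.sqrt d : ℂ)) = Complex.I * (Real.sqrt d : ℂ) := by
    rw [RingEquiv.symm_apply_eq, hσ]
  have hτy : coeffClass (R := ℂ) (S := ℂ) σ.toRingHom.toAddMonoidHom (2 * 2) y ∈ weilClassesMinus A φ 2 d :=
    coeffClass_mem_weilClassesMinus_of_fix σ.toRingHom hσ hy
  refine eq_of_beta'_eq_left hd hA hφ e ha ha0 hSU (coeffClass_mem_weilClassesPlus_of_fix σ.toRingHom hσ (hS'1 y hy))
    (hS'1 _ hτy) fun z' hz' ↦ ?_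
  set z₀ := coeffClass (R := ℂ) (S := ℂ) σ.symm.toRingHom.toAddMonoidHom (2 * 2) z' with hz₀
  have hz₀M : z₀ ∈ weilClassesMinus A φ 2 d := coeffClass_mem_weilClassesMinus_of_fix σ.symm.toRingHom hσ' hz'
  have hzz : z' = coeffClass (R := ℂ) (S := ℂ) σ.toRingHom.toAddMonoidHom (2 * 2) z₀ :=
    (coeffClass_ringEquiv_apply_symm σ z').symm
  rw [hzz, hS'2 _ hτy _ (coeffClass_mem_weilClassesMinus_of_fix σ.toRingHom hσ hz₀M)]
  conv_lhs => rw [← coeffClass_cupPowTwo_hK_four (φ := φ) e ha σ, tri_coeffClass hA σ, hS'2 y hy z₀ hz₀M]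
  conv_rhs => rw [← hτv', tri_coeffClass hA σ]

include hd hA hφ e ha ha0 hS1 hS2 hS'1 hS'2 in
/-- **`σ_*(s₋ y) = s₊(σ_* y)` for `y ∈ ⋀⁴W^*` when `σ(i√d) = -i√d` and `σ_* v' = v`.** [cite: FriedmanLaza2013, §3.5 Lemma 36]
[cite: Deligne1982HodgeCycles, I §3] -/
theorem starMinus_coeffClass_of_swap (hSU : HasHodgeGroupSU A φ 4 d (hK d φ e a))
    (hσ : σ (Complex.I * (Real.sqrt d : ℂ)) = -(Complex.I * (Real.sqrt d : ℂ)))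
    (hτv' : coeffClass (R := ℂ) (S := ℂ) σ.toRingHom.toAddMonoidHom (2 * 4) v' = v)
    {y : complexBetti A.X (2 * 2)} (hy : y ∈ weilClassesMinus A φ 2 d) :
    coeffClass (R := ℂ) (S := ℂ) σ.toRingHom.toAddMonoidHom (2 * 2) (S' y) =
      S (coeffClass (R := ℂ) (S := ℂ) σ.toRingHom.toAddMonoidHom (2 * 2) y) := by
  have hσ' : σ.symm (Complex.I * (Real.sqrt d : ℂ)) = -(Complex.I * (Real.sqrt d : ℂ)) := by
    rw [RingEquiv.symm_apply_eq, map_neg, hσ, neg_neg]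
  have hτy : coeffClass (R := ℂ) (S := ℂ) σ.toRingHom.toAddMonoidHom (2 * 2) y ∈ weilClassesPlus A φ 2 d :=
    coeffClass_mem_weilClassesPlus_of_swap σ.toRingHom hσ hy
  refine eq_of_beta_eq_right hd hA hφ e ha ha0 hSU (coeffClass_mem_weilClassesMinus_of_swap σ.toRingHom hσ (hS'1 y hy))
    (hS1 _ hτy) fun z hz ↦ ?_
  set z₀ := coeffClass (R := ℂ) (S := ℂ) σ.symm.toRingHom.toAddMonoidHom (2 * 2) z with hz₀
  have hz₀M : z₀ ∈ weilClassesMinus A φ 2 d := coeffClass_mem_weilClassesMinus_of_swap σ.symm.toRingHom hσ' hz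
  have hzz : z = coeffClass (R := ℂ) (S := ℂ) σ.toRingHom.toAddMonoidHom (2 * 2) z₀ := (coeffClass_ringEquiv_apply_symm σ z).symm
  rw [hzz, hS2 _ hτy _ (coeffClass_mem_weilClassesPlus_of_swap σ.toRingHom hσ hz₀M)]
  conv_lhs => rw [← coeffClass_cupPowTwo_hK_four (φ := φ) e ha σ, tri_coeffClass hA σ, hS'2 y hy z₀ hz₀M]
  conv_rhs => rw [← hτv', tri_coeffClass hA σ]

include hd hA hφ e ha ha0 hS1 hS2 hS'1 hS'2 in
/-- **`s₊ + s₋` commutes with `σ_*` on the Weil space `⋀⁴W ⊕ ⋀⁴W^*`** for EVERY `σ ∈ Aut(ℂ)`, provided `s₊` kills `⋀⁴W^*`, `s₋` kills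
`⋀⁴W`, and the data `(v', v)` are the components of a rational Weil class (fixed resp. exchanged by `σ_*`).
[cite: FriedmanLaza2013, §3.5 Prop. 37] [cite: Deligne1982HodgeCycles, I §3] -/
theorem starSum_coeffClass_comm (hSU : HasHodgeGroupSU A φ 4 d (hK d φ e a))
    (hS0 : ∀ y ∈ weilClassesMinus A φ 2 d, S y = 0) (hS'0 : ∀ x ∈ weilClassesPlus A φ 2 d, S' x = 0)
    (hv' : v' ∈ weilClassesPlus A φ 4 d) (hv : v ∈ weilClassesMinus A φ 4 d) (hw : IsRationalClass (v' + v))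
    {c : complexBetti A.X (2 * 2)} (hc : c ∈ weilClassesOf A φ 2 d) :
    coeffClass (R := ℂ) (S := ℂ) σ.toRingHom.toAddMonoidHom (2 * 2) ((S + S') c) =
      (S + S') (coeffClass (R := ℂ) (S := ℂ) σ.toRingHom.toAddMonoidHom (2 * 2) c) := by
  obtain ⟨x, hx, y, hy, rfl⟩ := Submodule.mem_sup.1 hc
  have eL : (S + S') (x + y) = S x + S' y := by
    rw [LinearMap.add_apply, map_add, map_add, hS0 y hy, hS'0 x hx, add_zero, zero_add]
  rw [eL, map_add, map_add]
  rcases ringHom_I_mul_sqrt σ.toRingHom d with hσ | hσ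
  · have hσe : σ (Complex.I * (Real.sqrt d : ℂ)) = Complex.I * (Real.sqrt d : ℂ) := hσ
    obtain ⟨hτv', hτv⟩ := coeffClass_weilComponents_of_fix hd σ hσe hv' hv hw
    have hτx := coeffClass_mem_weilClassesPlus_of_fix σ.toRingHom hσ hx
    have hτy := coeffClass_mem_weilClassesMinus_of_fix σ.toRingHom hσ hy
    have eR : (S + S') (coeffClass (R := ℂ) (S := ℂ) σ.toRingHom.toAddMonoidHom (2 * 2) x +
        coeffClass (R := ℂ) (S := ℂ) σ.toRingHom.toAddMonoidHom (2 * 2) y) =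
        S (coeffClass (R := ℂ) (S := ℂ) σ.toRingHom.toAddMonoidHom (2 * 2) x) +
          S' (coeffClass (R := ℂ) (S := ℂ) σ.toRingHom.toAddMonoidHom (2 * 2) y) := by
      rw [LinearMap.add_apply, map_add, map_add, hS0 _ hτy, hS'0 _ hτx, add_zero, zero_add]
    rw [eR, starPlus_coeffClass_of_fix hd hA hφ e ha ha0 σ S v hS1 hS2 hSU hσe hτv hx,
      starMinus_coeffClass_of_fix hd hA hφ e ha ha0 σ S' v' hS'1 hS'2 hSU hσe hτv' hy]
  · have hσe : σ (Complex.I * (Real.sqrt d : ℂ)) = -(Complex.I * (Real.sqrt d : ℂ)) := hσ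
    obtain ⟨hτv', hτv⟩ := coeffClass_weilComponents_of_swap hd σ hσe hv' hv hw
    have hτx := coeffClass_mem_weilClassesMinus_of_swap σ.toRingHom hσ hx
    have hτy := coeffClass_mem_weilClassesPlus_of_swap σ.toRingHom hσ hy
    have eR : (S + S') (coeffClass (R := ℂ) (S := ℂ) σ.toRingHom.toAddMonoidHom (2 * 2) x +
        coeffClass (R := ℂ) (S := ℂ) σ.toRingHom.toAddMonoidHom (2 * 2) y) =
        S (coeffClass (R := ℂ) (S := ℂ) σ.toRingHom.toAddMonoidHom (2 * 2) y) +
          S' (coeffClass (R := ℂ) (S := ℂ) σ.toRingHom.toAddMonoidHom (2 * 2) x) := by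
      rw [LinearMap.add_apply, map_add, map_add, hS0 _ hτx, hS'0 _ hτy, zero_add, add_zero]
    rw [eR, starPlus_coeffClass_of_swap hd hA hφ e ha ha0 σ S S' v v' hS1 hS2 hS'1 hS'2 hSU hσe hτv hx,
      starMinus_coeffClass_of_swap hd hA hφ e ha ha0 σ S S' v v' hS1 hS2 hS'1 hS'2 hSU hσe hτv' hy, add_comm]

end Galois

end Summit.HodgeConjecture.HodgeConjecture.Theorems.CYFormCarrier

end
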